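import Summits.Ventures.Crystal3D.Bulk.HullRotSysAngles
import HarnessLib

/-!
# The LINK LEMMA of the ear induction for LEMMA L: a corner of a sub-map of the hull fan that
# sweeps less than `π` is a LEFT turn (route 1 of `HOME/lean/lemmaL/DESIGN.md`, step R1.7)

HONEST FRAMING. Part of the venture `Summits/Ventures/Crystal3D` (cell `pub-crystal3d`, phase 2;
seat p3), generic and configuration-free (`X` any finite set of unit vectors of `ℝ³` with `0`
interior to its hull); nothing here mentions GAP(1.26). The ear induction proving that the faces
of the tight map are convex (`Bulk/ConvexPositionGluing.lean`: `convexPos_snoc` needs the three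
local ORIENTATION signs) carries the hypothesis "all corners `< π`" as REAL NUMBERS (the corner
`RotSys.cornerAt σ_H (fan angles) S z` of `Bulk/RotSysCorners.lean` — the fan angles swept from
the dart `z = (y, b)` to its `S`-successor `(y, p)`, a sum that only shrinks when a diagonal is
added to `S`). This file converts the real-number hypothesis into the sign the gluing lemma
consumes:

* **`HullRotSys.orient3_pos_of_cornerAt_lt_pi`** — for ANY `S ⊆ hullDarts X` and `z = (y, b) ∈ S`
  with `S`-successor `induce σ_H S z = (y, p)`: if `cornerAt σ_H (dartWeight X) S z < π` then
  `0 < orient3 y b p`.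

Proof: in an azimuth enumeration `nb` of the fan neighbours of `y` with `b = nb K`, the swept
corner telescopes to a lifted-azimuth difference `Θ(K + n) − Θ(K)` (right-handed tangent frame;
`Θ(K + d) − Θ(K + d − n)` for a left-handed one), which therefore lies in `(0, π)`; and
`orient3 y b p = trad b · trad p · sin(azimuth gap) · det(frame)` (`orient3_polar`), the azimuth
gap being that difference up to a multiple of `2π` and up to the sign of the frame.
-/

noncomputable section

namespace Summit.Ventures.Crystal3D

namespace HullRotSys

open Literature.Geometry.DiscreteGeometry Finset Equiv Real InnerProductGeometry

variable {X : Finset (EuclideanSpace ℝ (Fin 3))} {hX1 : ∀ y ∈ X, ‖y‖ = 1}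
  {h0 : (0 : EuclideanSpace ℝ (Fin 3)) ∈ interior (convexHull ℝ (X : Set _))}

/-- The azimuth of an enumerated neighbour in terms of the lifted azimuth:
`azimuth (nb q) = Θ q − 2π·⌊q/d⌋`. -/
theorem azimuth_nb_eq_liftAz_sub {y : EuclideanSpace ℝ (Fin 3)} {hy : ‖y‖ = 1} (E : NbrEnum X y hy)
    (q : ℕ) : azimuth y hy (E.nb q) = liftAz E q - 2 * π * ((q / E.d : ℕ) : ℝ) := by
  unfold liftAz; ring

/-- The lifted azimuth is strictly increasing: `Θ q < Θ (q + n)` for `0 < n`. -/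
theorem liftAz_lt_liftAz_add {y : EuclideanSpace ℝ (Fin 3)} {hy : ‖y‖ = 1}
    (hX1 : ∀ y ∈ X, ‖y‖ = 1)
    (h0 : (0 : EuclideanSpace ℝ (Fin 3)) ∈ interior (convexHull ℝ (X : Set _)))
    (E : NbrEnum X y hy) (q : ℕ) {n : ℕ} (hn : 0 < n) : liftAz E q < liftAz E (q + n) := by
  have hstep : ∀ t, liftAz E t < liftAz E (t + 1) := by
    intro t
    have h := angle_nb_succ_eq_liftAz_sub hX1 h0 E t
    -- the gap is an angle between NON-parallel tangent projections, hence `> 0`: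
    -- we read positivity off the sine of the azimuth gap instead
    have hs := sin_azimuth_gap_pos hX1 h0 E t
    have hq : azimuth y hy (E.nb (t + 1)) - azimuth y hy (E.nb t) =
        (liftAz E (t + 1) - liftAz E t) + 2 * π * (((t / E.d : ℕ) : ℝ) - (((t + 1) / E.d : ℕ) : ℝ)) := by
      rw [azimuth_nb_eq_liftAz_sub, azimuth_nb_eq_liftAz_sub]; ring
    -- `⌊(t+1)/d⌋ − ⌊t/d⌋ ∈ {0, 1}`
    have hdiv : (t + 1) / E.d = t / E.d ∨ (t + 1) / E.d = t / E.d + 1 := by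
      have h1 : t / E.d ≤ (t + 1) / E.d := Nat.div_le_div_right (Nat.le_succ t)
      have h2 : (t + 1) / E.d ≤ t / E.d + 1 := by
        have := Nat.succ_div (a := t) (b := E.d)
        split_ifs at this <;> omega
      omega
    have hnn : 0 ≤ liftAz E (t + 1) - liftAz E t := by rw [← h]; exact angle_nonneg _ _
    rcases hnn.lt_or_eq with hlt | heq
    · linarith
    · exfalso
      rcases hdiv with hd | hd
      · rw [hq, ← heq, hd, sub_self, mul_zero, zero_add, Real.sin_zero] at hs
        exact lt_irrefl _ hs
      · rw [hq, ← heq, hd] at hs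
        push_cast at hs
        have : Real.sin (0 + 2 * π * ((((t / E.d : ℕ) : ℝ)) - (((t / E.d : ℕ) : ℝ) + 1))) = 0 := by
          rw [show (0 : ℝ) + 2 * π * ((((t / E.d : ℕ) : ℝ)) - (((t / E.d : ℕ) : ℝ) + 1)) =
            0 - ((1 : ℕ) : ℝ) * (2 * π) by push_cast; ring, Real.sin_sub_nat_mul_two_pi, Real.sin_zero]
        rw [this] at hs
        exact lt_irrefl _ hs
  induction n with
  | zero => exact absurd hn (lt_irrefl 0)
  | succ n ih =>
    rcases Nat.eq_zero_or_pos n with rfl | hpos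
    · simpa using hstep q
    · exact (ih hpos).trans (by rw [← Nat.add_assoc]; exact hstep (q + n))

/-- **THE LINK LEMMA.** For any `S ⊆ hullDarts X` and any dart `z = (y, b) ∈ S` whose corner in
the sub-map `S` (fan angles swept from `z` to its `S`-successor `(y, p) = induce σ_H S z`) is
`< π`, the turn is a LEFT turn seen from outside: `0 < orient3 y b p`. -/
theorem orient3_pos_of_cornerAt_lt_pi (S : Finset ↥(hullDarts X)) {z : ↥(hullDarts X)}
    (hz : z ∈ S) (hlt : RotSys.cornerAt (rot hX1 h0) (dartWeight X) S z < π) :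
    0 < orient3 z.1.1 z.1.2 (RotSys.induce (rot hX1 h0) S z).1.2 := by
  obtain ⟨⟨y, a⟩, hz0⟩ := z
  have hyX : y ∈ X := fst_mem_of_mem_hullDarts hX1 hz0
  have hy : ‖y‖ = 1 := hX1 y hyX
  have ha : a ∈ fanNbrs X y := mk_mem_hullDarts_iff.1 hz0
  obtain ⟨E⟩ := nonempty_nbrEnum hX1 hy ⟨a, ha⟩
  obtain ⟨K, hK, hKa⟩ := E.surj a ha
  have hd := E.d_pos
  set D := orient3 (tangentFrame y hy 0) (tangentFrame y hy 1) (tangentFrame y hy 2) with hDdef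
  -- the first-return time `n` and the successor
  set n := RotSys.retTime (rot hX1 h0) S ⟨(y, a), hz0⟩ with hndef
  obtain ⟨hn0, hnS⟩ := RotSys.retTime_spec (rot hX1 h0) hz
  rw [← hndef] at hn0 hnS
  rw [RotSys.induce_apply_of_mem _ hz, ← hndef]
  simp only
  -- polar data
  have ha1 : ‖a‖ = 1 := norm_eq_one_of_mem_fanNbrs hX1 ha
  have hta : 0 < trad y a := trad_pos_of_mem_fanNbrs hX1 ha
  have hazK : azimuth y hy a = liftAz E K := by rw [← hKa, liftAz_of_lt E hK]
  rcases lt_or_gt_of_ne (orient3_orthonormalBasis_ne_zero (tangentFrame y hy)) with hneg | hpos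
  · -- LEFT-HANDED frame: `σ_H` walks the enumeration backwards
    have hit : ∀ m, m ≤ K + E.d →
        ((rot hX1 h0 ^ m) ⟨(y, a), hz0⟩).1 = (y, E.nb (K + E.d - m)) := by
      intro m hm
      rw [rot_pow_apply_val]
      change (hullSucc X)^[m] (y, a) = _
      rw [← hKa, ← E.periodic K]
      exact iterate_hullSucc_nb_of_det_neg hX1 h0 E hneg hm
    -- `n ≤ d`: the full turn returns to `z ∈ S`
    have hnd : n ≤ E.d := by
      refine RotSys.retTime_le_of_mem (rot hX1 h0) hz hd ?_
      have : (rot hX1 h0 ^ E.d) ⟨(y, a), hz0⟩ = ⟨(y, a), hz0⟩ := by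
        apply Subtype.ext
        rw [hit E.d (by omega), show K + E.d - E.d = K by omega, hKa]
      rw [this]; exact hz
    -- the successor's head
    have hp : ((rot hX1 h0 ^ n) ⟨(y, a), hz0⟩).1.2 = E.nb (K + E.d - n) := by
      rw [hit n (by omega)]
    rw [hp]
    -- the corner telescopes to `Θ(K + d) − Θ(K + d − n)`
    have hsum : RotSys.cornerAt (rot hX1 h0) (dartWeight X) S ⟨(y, a), hz0⟩ =
        liftAz E (K + E.d) - liftAz E (K + E.d - n) := by
      unfold RotSys.cornerAt
      rw [← hndef]
      have hterm : ∀ t ∈ range n, dartWeight X ((rot hX1 h0 ^ t) ⟨(y, a), hz0⟩) =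
          liftAz E (K + E.d - n + (n - 1 - t) + 1) - liftAz E (K + E.d - n + (n - 1 - t)) := by
        intro t ht
        rw [mem_range] at ht
        rw [dartWeight_apply, hit t (by omega)]
        simp only
        rw [show K + E.d - t = (K + E.d - n + (n - 1 - t)) + 1 by omega,
          succV_nb_of_det_neg hX1 h0 E hneg, angle_comm, angle_nb_succ_eq_liftAz_sub hX1 h0 E]
      rw [Finset.sum_congr rfl hterm, Finset.sum_range_reflect (fun t =>
        liftAz E (K + E.d - n + t + 1) - liftAz E (K + E.d - n + t)) n]
      have h := Finset.sum_range_sub (fun t => liftAz E (K + E.d - n + t)) n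
      simp only [Nat.add_zero] at h
      rw [show K + E.d - n + n = K + E.d by omega] at h
      rw [← h]
      exact Finset.sum_congr rfl fun t _ => by rw [Nat.add_assoc]
    set Δ := liftAz E (K + E.d) - liftAz E (K + E.d - n) with hΔ
    have hΔlt : Δ < π := by rw [← hsum]; exact hlt
    have hΔpos : 0 < Δ := by
      have := liftAz_lt_liftAz_add hX1 h0 E (K + E.d - n) hn0
      rw [show K + E.d - n + n = K + E.d by omega] at this
      rw [hΔ]; linarith
    -- the polar formula
    have hp1 : ‖E.nb (K + E.d - n)‖ = 1 := norm_eq_one_of_mem_fanNbrs hX1 (E.mem _)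
    have htp : 0 < trad y (E.nb (K + E.d - n)) := trad_pos_of_mem_fanNbrs hX1 (E.mem _)
    have hpol := orient3_polar (polarRep_azimuth (y := y) (hy := hy) ha1)
      (polarRep_azimuth (y := y) (hy := hy) hp1)
    rw [hpol, ← hDdef]
    -- the azimuth gap is `−Δ` up to a multiple of `2π`
    set q : ℕ := (K + E.d - n) / E.d with hq
    have hgap : azimuth y hy (E.nb (K + E.d - n)) - azimuth y hy a =
        -Δ + (((1 : ℤ) - (q : ℤ) : ℤ) : ℝ) * (2 * π) := by
      rw [azimuth_nb_eq_liftAz_sub, ← hq, hazK, hΔ,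
        show liftAz E K = liftAz E (K + E.d) - 2 * π by rw [liftAz_add_d]; ring]
      push_cast; ring
    have hsin : Real.sin (azimuth y hy (E.nb (K + E.d - n)) - azimuth y hy a) = -Real.sin Δ := by
      rw [hgap, Real.sin_add_int_mul_two_pi, Real.sin_neg]
    rw [hsin]
    have hsΔ : 0 < Real.sin Δ := Real.sin_pos_of_pos_of_lt_pi hΔpos hΔlt
    have : 0 < trad y a * trad y (E.nb (K + E.d - n)) * Real.sin Δ * (-D) := by
      have hD' : 0 < -D := neg_pos.2 hneg
      positivity
    linarith [this]
  · -- RIGHT-HANDED frame: `σ_H` walks the enumeration forwards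
    have hit : ∀ m, ((rot hX1 h0 ^ m) ⟨(y, a), hz0⟩).1 = (y, E.nb (K + m)) := by
      intro m
      rw [rot_pow_apply_val]
      change (hullSucc X)^[m] (y, a) = _
      rw [← hKa]
      exact iterate_hullSucc_nb_of_det_pos hX1 h0 E hpos m K
    have hp : ((rot hX1 h0 ^ n) ⟨(y, a), hz0⟩).1.2 = E.nb (K + n) := by rw [hit n]
    rw [hp]
    -- the corner telescopes to `Θ(K + n) − Θ(K)`
    have hsum : RotSys.cornerAt (rot hX1 h0) (dartWeight X) S ⟨(y, a), hz0⟩ =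
        liftAz E (K + n) - liftAz E K := by
      unfold RotSys.cornerAt
      rw [← hndef]
      have hterm : ∀ t ∈ range n, dartWeight X ((rot hX1 h0 ^ t) ⟨(y, a), hz0⟩) =
          angle (perpTo y (E.nb (K + t))) (perpTo y (E.nb (K + t + 1))) := by
        intro t _
        rw [dartWeight_apply, hit t]
        simp only
        rw [succV_nb_of_det_pos hX1 h0 E hpos]
      rw [Finset.sum_congr rfl hterm, sum_angle_nb_eq_liftAz_sub hX1 h0 E]
    set Δ := liftAz E (K + n) - liftAz E K with hΔ
    have hΔlt : Δ < π := by rw [← hsum]; exact hlt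
    have hΔpos : 0 < Δ := by
      have := liftAz_lt_liftAz_add hX1 h0 E K hn0
      rw [hΔ]; linarith
    have hp1 : ‖E.nb (K + n)‖ = 1 := norm_eq_one_of_mem_fanNbrs hX1 (E.mem _)
    have htp : 0 < trad y (E.nb (K + n)) := trad_pos_of_mem_fanNbrs hX1 (E.mem _)
    have hpol := orient3_polar (polarRep_azimuth (y := y) (hy := hy) ha1)
      (polarRep_azimuth (y := y) (hy := hy) hp1)
    rw [hpol, ← hDdef]
    set q : ℕ := (K + n) / E.d with hq
    have hgap : azimuth y hy (E.nb (K + n)) - azimuth y hy a = Δ - (q : ℝ) * (2 * π) := by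
      rw [azimuth_nb_eq_liftAz_sub, ← hq, hazK, hΔ]; ring
    have hsin : Real.sin (azimuth y hy (E.nb (K + n)) - azimuth y hy a) = Real.sin Δ := by
      rw [hgap, Real.sin_sub_nat_mul_two_pi]
    rw [hsin]
    have hsΔ : 0 < Real.sin Δ := Real.sin_pos_of_pos_of_lt_pi hΔpos hΔlt
    positivity

/-- The same conclusion with the successor written as an iterate of `σ_H`: if
`(σ_H ^ n) z ∈ S` is the FIRST return (`0 < n`, no earlier positive iterate in `S`) and the swept
fan angles `Σ_{t<n} dartWeight (σ_H^t z)` are `< π`, then `0 < orient3 y b ((σ_H^n z).1.2)`. -/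
theorem orient3_pos_of_sum_lt_pi (S : Finset ↥(hullDarts X)) {z : ↥(hullDarts X)} (hz : z ∈ S)
    {n : ℕ} (hn0 : 0 < n) (hmem : (rot hX1 h0 ^ n) z ∈ S)
    (hmin : ∀ m, 0 < m → m < n → (rot hX1 h0 ^ m) z ∉ S)
    (hlt : ∑ t ∈ range n, dartWeight X ((rot hX1 h0 ^ t) z) < π) :
    0 < orient3 z.1.1 z.1.2 ((rot hX1 h0 ^ n) z).1.2 := by
  have hret : RotSys.retTime (rot hX1 h0) S z = n :=
    RotSys.retTime_eq_of_first_return _ hz hn0 hmem hmin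
  have h := orient3_pos_of_cornerAt_lt_pi (hX1 := hX1) (h0 := h0) S hz (by
    unfold RotSys.cornerAt; rw [hret]; exact hlt)
  rwa [RotSys.induce_apply_of_mem _ hz, hret] at h

end HullRotSys

end Summit.Ventures.Crystal3D
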